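import Literature.NumberTheory.LFunctions.KadiriTestFunction
import HarnessLib

/-!
# The third-order form of Kadiri's Lemma 3.2 for the kernel of Mossinghoff–Trudgian–Yang (9.2)

Topic `Literature/NumberTheory/LFunctions`. Everything in this file is PROVED (two abbreviating
definitions, `mtyH1Deriv3` and `mtyM3`; no named fact). Kadiri's Lemma 3.2 (Acta Arith. 117
(2005), §3; tree: `kadiri_lemma32_scaled`, `KadiriTest.abs_re_fordLaplace_sub_le`) writes the Laplace
transform of the test function `f(t) = η h(ηt)` as `F̃(x, y) = ηg₁ x/(x²+y²) + H(x, y)` with the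
SECOND-order remainder `|H| ≤ M(x/η) η²/(x²+y²)`, `M(x) = ∫₀^{d₁}|h''(u)|e^{−xu}du`, obtained by two
integrations by parts from the conditions (H₁) `f(d) = f'(0) = f'(d) = 0`. The kernel
`h = h^{(1)}_{1,θ}` of Mossinghoff–Trudgian–Yang (9.2) satisfies the FOURTH condition of (H₁) as
well, `f''(d) = 0` (tree: `mtyH1Deriv2_d1`), so one more integration by parts is available:

  `F(z) = f(0)/z + f''(0)/z³ + z⁻³ ∫₀^d f'''(t) e^{−zt} dt`,

whence the THIRD-order remainder `|H(x, y)| ≤ M₃(x/η) η³/(x²+y²)^{3/2}` with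
`M₃(x) = |h''(0)| + ∫₀^{d₁} |h'''(u)| e^{−xu} du` (`mtyM3`). For the zeros at distance `|y| ≥ t₀`
from the point `σ + it` of Kadiri's method this gives `|H| ≤ (M₃ η/t₀) · η²/y²`, the shape of the
tree's `KadiriZeroSum.abs_H_le` with the constant `M* = M₃(−r/R) η₀/t₀`, which is small already
for moderate `t₀` (the use made of it in `KadiriZeroSum3.lean`: Kadiri's method with the far/near
splitting height `t₀ = 101`, below which the Riemann hypothesis is proved in the tree,
`riemannHypothesisUpTo_hundredOne`). Also recorded: the closed form of `h'''`
(`mtyH1Deriv3`, `hasDerivAt_mtyH1Deriv2`), `M₃` antitone and `≥ 0`, the crude bounds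
`|h'''| ≤ tan²θ sec²θ (sec²θ (3/2 + θ) + tan θ/sin 2θ + 2 tan θ/sin θ)` on `[0, d₁]` and
`M₃(x) ≤ |h''(0)| + d₁ m₃ e^{|x| d₁}`.

## References

* H. Kadiri, *Une région explicite sans zéros pour la fonction ζ de Riemann*, Acta Arith. 117
  (2005) 303–339 = arXiv:math/0401238, §2.2 (H₁), Lemma 3.2 and its proof. [Kadiri2005]
* M. J. Mossinghoff, T. S. Trudgian, A. Yang, *Explicit zero-free regions for the Riemann
  zeta-function*, Res. Number Theory 10 (2024) = arXiv:2212.06867, §9, (9.2).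
  [MossinghoffTrudgianYangRNT2024]
-/

noncomputable section

open Complex Real MeasureTheory Set

namespace Literature.NumberTheory.LFunctions

/-! ## The third derivative of the kernel -/

/-- The third derivative of `h^{(1)}_{λ,θ}` (MTY (9.2)) in closed form: with `x = λu tan θ`,
`h''' = λ⁴ tan²θ sec²θ { sec²θ ((3/2) cos x + (θ − x/2) sin x) + tan θ cos(2θ − x)/sin 2θ
  − 2 tan θ cos(θ − x)/sin θ }`. [cite: MossinghoffTrudgianYangRNT2024, (9.2)] -/
def mtyH1Deriv3 (lam θ u : ℝ) : ℝ :=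
  lam ^ 4 * Real.tan θ ^ 2 / Real.cos θ ^ 2 *
    (1 / Real.cos θ ^ 2 * (3 / 2 * Real.cos (lam * u * Real.tan θ)
        + (θ - lam * u * Real.tan θ / 2) * Real.sin (lam * u * Real.tan θ))
      + Real.tan θ * Real.cos (2 * θ - lam * u * Real.tan θ) / Real.sin (2 * θ)
      - 2 * Real.tan θ * Real.cos (θ - lam * u * Real.tan θ) / Real.sin θ)

/-- `h'''` of the kernel is continuous. [folklore] -/
theorem continuous_mtyH1Deriv3 (lam θ : ℝ) : Continuous (mtyH1Deriv3 lam θ) := by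
  unfold mtyH1Deriv3; fun_prop

/-- `d/du mtyH1Deriv2 λ θ u = mtyH1Deriv3 λ θ u`. [cite: MossinghoffTrudgianYangRNT2024, (9.2)] -/
theorem hasDerivAt_mtyH1Deriv2 (lam θ u : ℝ) :
    HasDerivAt (mtyH1Deriv2 lam θ) (mtyH1Deriv3 lam θ u) u := by
  set T := Real.tan θ with hT
  set S := 1 / Real.cos θ ^ 2 with hS
  have hx : ∀ y : ℝ, HasDerivAt (fun y : ℝ ↦ lam * y * T) (lam * T) y := fun y ↦ by
    simpa using ((hasDerivAt_id y).const_mul lam).mul_const T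
  have h1 : HasDerivAt (fun y : ℝ ↦ Real.sin (lam * y * T))
      (Real.cos (lam * u * T) * (lam * T)) u :=
    (Real.hasDerivAt_sin _).comp u (hx u)
  have h2 : HasDerivAt (fun y : ℝ ↦ (θ - lam * y * T / 2) * Real.cos (lam * y * T))
      (-(lam * T / 2) * Real.cos (lam * u * T)
        + (θ - lam * u * T / 2) * (-Real.sin (lam * u * T) * (lam * T))) u := by
    have ha : HasDerivAt (fun y : ℝ ↦ θ - lam * y * T / 2) (-(lam * T / 2)) u := by
      simpa using ((hx u).div_const 2).const_sub θ
    exact ha.mul ((Real.hasDerivAt_cos _).comp u (hx u))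
  have h3 : HasDerivAt (fun y : ℝ ↦ T * Real.sin (2 * θ - lam * y * T) / Real.sin (2 * θ))
      (T * (Real.cos (2 * θ - lam * u * T) * (-(lam * T))) / Real.sin (2 * θ)) u :=
    (((Real.hasDerivAt_sin _).comp u ((hx u).const_sub (2 * θ))).const_mul T).div_const _
  have h4 : HasDerivAt (fun y : ℝ ↦ 2 * T * Real.sin (θ - lam * y * T) / Real.sin θ)
      (2 * T * (Real.cos (θ - lam * u * T) * (-(lam * T))) / Real.sin θ) u :=
    (((Real.hasDerivAt_sin _).comp u ((hx u).const_sub θ)).const_mul (2 * T)).div_const _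
  have hsum := ((((h1.sub h2).const_mul S).sub h3).add h4).const_mul (lam ^ 3 * T * S)
  have hfun : mtyH1Deriv2 lam θ = fun y ↦ lam ^ 3 * T * S *
      (S * ((fun y ↦ Real.sin (lam * y * T)) y
        - (fun y ↦ (θ - lam * y * T / 2) * Real.cos (lam * y * T)) y)
      - (fun y ↦ T * Real.sin (2 * θ - lam * y * T) / Real.sin (2 * θ)) y
      + (fun y ↦ 2 * T * Real.sin (θ - lam * y * T) / Real.sin θ) y) := by
    funext y
    simp only [mtyH1Deriv2, ← hT, hS]
    ring
  rw [hfun]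
  refine hsum.congr_deriv ?_
  simp only [mtyH1Deriv3, ← hT, hS]
  ring

/-- `deriv mtyH1Deriv2 λ θ = mtyH1Deriv3 λ θ`. [folklore] -/
theorem deriv_mtyH1Deriv2 (lam θ : ℝ) : deriv (mtyH1Deriv2 lam θ) = mtyH1Deriv3 lam θ :=
  funext fun u ↦ (hasDerivAt_mtyH1Deriv2 lam θ u).deriv

/-! ## Three integrations by parts -/

/-- **Three integrations by parts.** If `f ∈ C³` with `f(d) = 0`, `f'(0) = 0`, `f'(d) = 0` and
`f''(d) = 0` (all four conditions (H₁) of Kadiri), then for every complex `z ≠ 0`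
`∫₀^d f(t) e^{−zt} dt = f(0)/z + f''(0)/z³ + z⁻³ ∫₀^d f'''(t) e^{−zt} dt`.
[cite: Kadiri2005, Lemma 3.2 (proof) and §2.2 (H₁)] -/
theorem laplace_eq_of_H1_third {f f' f'' f''' : ℝ → ℝ} {d : ℝ}
    (hf : ∀ t, HasDerivAt f (f' t) t) (hf' : ∀ t, HasDerivAt f' (f'' t) t)
    (hf'' : ∀ t, HasDerivAt f'' (f''' t) t) (hf'''c : Continuous f''')
    (hfd : f d = 0) (hf'0 : f' 0 = 0) (hf'd : f' d = 0) (hf''d : f'' d = 0) {z : ℂ} (hz : z ≠ 0) :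
    ∫ t in (0 : ℝ)..d, (f t : ℂ) * Complex.exp (-(z * t))
      = f 0 / z + f'' 0 / z ^ 3
        + 1 / z ^ 3 * ∫ t in (0 : ℝ)..d, (f''' t : ℂ) * Complex.exp (-(z * t)) := by
  have hf''c : Continuous f'' := continuous_iff_continuousAt.2 fun t ↦ (hf'' t).continuousAt
  rw [laplace_eq_of_H1 hf hf' hf''c hfd hf'0 hf'd hz]
  -- the primitive `v(t) = -e^{-zt}/z` of `e^{-zt}`
  set v : ℝ → ℂ := fun t ↦ -Complex.exp (-(z * t)) / z with hv
  have hvd : ∀ t : ℝ, HasDerivAt v (Complex.exp (-(z * (t : ℂ)))) t := by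
    intro t
    have := ((hasDerivAt_cexp_neg_mul z t).neg).div_const z
    refine this.congr_deriv ?_
    field_simp
  have hec : Continuous fun t : ℝ ↦ Complex.exp (-(z * t)) := by fun_prop
  -- the third integration by parts
  have h3 := intervalIntegral.integral_mul_deriv_eq_deriv_mul (a := 0) (b := d)
    (u := fun t ↦ (f'' t : ℂ)) (u' := fun t ↦ (f''' t : ℂ)) (v := v) (v' := fun t ↦ Complex.exp (-(z * t)))
    (fun t _ ↦ (hf'' t).ofReal_comp) (fun t _ ↦ hvd t)
    ((Complex.continuous_ofReal.comp hf'''c).intervalIntegrable _ _) (hec.intervalIntegrable _ _)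
  beta_reduce at h3
  have hv0 : v 0 = -1 / z := by simp [hv]
  rw [hf''d, hv0] at h3
  simp only [Complex.ofReal_zero, zero_mul, zero_sub] at h3
  have hv' : ∫ t in (0 : ℝ)..d, (f''' t : ℂ) * v t
      = -(1 / z) * ∫ t in (0 : ℝ)..d, (f''' t : ℂ) * Complex.exp (-(z * t)) := by
    rw [← intervalIntegral.integral_const_mul]
    refine intervalIntegral.integral_congr fun t _ ↦ ?_
    simp only [hv]
    field_simp
  rw [hv'] at h3
  rw [h3]
  field_simp
  ring

/-- **Kadiri's Lemma 3.2, third-order form, for a general test function with all of (H₁).**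
With `F̃(x, y) = Re ∫₀^d f(t) e^{−(x+iy)t} dt`:
`|F̃(x, y) − f(0) x/(x² + y²)| ≤ (|f''(0)| + ∫₀^d |f'''(t)| e^{−xt} dt)/(x² + y²)^{3/2}`
for `(x, y) ≠ (0, 0)`. [cite: Kadiri2005, Lemma 3.2] -/
theorem kadiri_lemma32_third {f f' f'' f''' : ℝ → ℝ} {d : ℝ} (hd : 0 ≤ d)
    (hf : ∀ t, HasDerivAt f (f' t) t) (hf' : ∀ t, HasDerivAt f' (f'' t) t)
    (hf'' : ∀ t, HasDerivAt f'' (f''' t) t) (hf'''c : Continuous f''')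
    (hfd : f d = 0) (hf'0 : f' 0 = 0) (hf'd : f' d = 0) (hf''d : f'' d = 0) {z : ℂ} (hz : z ≠ 0) :
    |(∫ t in (0 : ℝ)..d, (f t : ℂ) * Complex.exp (-(z * t))).re - f 0 * z.re / ‖z‖ ^ 2|
      ≤ (|f'' 0| + ∫ t in (0 : ℝ)..d, |f''' t| * Real.exp (-(z.re * t))) / ‖z‖ ^ 3 := by
  rw [laplace_eq_of_H1_third hf hf' hf'' hf'''c hfd hf'0 hf'd hf''d hz, Complex.add_re,
    Complex.add_re, re_ofReal_div, add_assoc, add_sub_cancel_left]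
  have hz3 : 0 < ‖z‖ ^ 3 := by positivity
  have hA : |((f'' 0 : ℂ) / z ^ 3).re| ≤ |f'' 0| / ‖z‖ ^ 3 := by
    refine (Complex.abs_re_le_norm _).trans ?_
    rw [norm_div, norm_pow, Complex.norm_real, Real.norm_eq_abs]
  have hB : |(1 / z ^ 3 * ∫ t in (0 : ℝ)..d, (f''' t : ℂ) * Complex.exp (-(z * t))).re|
      ≤ (∫ t in (0 : ℝ)..d, |f''' t| * Real.exp (-(z.re * t))) / ‖z‖ ^ 3 := by
    refine (Complex.abs_re_le_norm _).trans ?_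
    calc ‖1 / z ^ 3 * ∫ t in (0 : ℝ)..d, (f''' t : ℂ) * Complex.exp (-(z * t))‖
        = ‖∫ t in (0 : ℝ)..d, (f''' t : ℂ) * Complex.exp (-(z * t))‖ / ‖z‖ ^ 3 := by
          rw [norm_mul, norm_div, norm_one, norm_pow]; ring
      _ ≤ _ := div_le_div_of_nonneg_right (norm_laplace_le f''' hd z) hz3.le
  calc |((f'' 0 : ℂ) / z ^ 3).re + (1 / z ^ 3 * ∫ t in (0 : ℝ)..d, (f''' t : ℂ) * Complex.exp (-(z * t))).re|
      ≤ |((f'' 0 : ℂ) / z ^ 3).re| + |(1 / z ^ 3 * ∫ t in (0 : ℝ)..d, (f''' t : ℂ) * Complex.exp (-(z * t))).re| :=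
        abs_add_le _ _
    _ ≤ |f'' 0| / ‖z‖ ^ 3 + (∫ t in (0 : ℝ)..d, |f''' t| * Real.exp (-(z.re * t))) / ‖z‖ ^ 3 :=
        add_le_add hA hB
    _ = _ := by rw [add_div]

/-! ## Specialisation to the kernel `h^{(1)}_{1,θ}` -/

/-- `M₃(x) = |h''(0)| + ∫₀^{d₁(θ)} |h'''(u)| e^{−xu} du` for `h = h^{(1)}_{1,θ}`: the constant of the
third-order remainder in Lemma 3.2. A definition (real-valued function), not a claim.
[cite: Kadiri2005, Lemma 3.2] -/
def mtyM3 (θ x : ℝ) : ℝ :=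
  |mtyH1Deriv2 1 θ 0| + ∫ u in (0 : ℝ)..mtyD1 θ, |mtyH1Deriv3 1 θ u| * Real.exp (-(x * u))

/-- **`F(z) = g₁(θ)/z + h''(0)/z³ + F₃(z)/z³` for the MTY kernel** (`0 < θ < π/2`, `z ≠ 0`), from
all four (H₁) conditions `h(d₁) = h'(0) = h'(d₁) = h''(d₁) = 0` of the tree.
[cite: Kadiri2005, Lemma 3.2 (proof)] [cite: MossinghoffTrudgianYangRNT2024, (9.2)] -/
theorem mtyH1_laplace_eq_third {θ : ℝ} (hθ : 0 < θ) (hθ' : θ < π / 2) {z : ℂ} (hz : z ≠ 0) :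
    ∫ u in (0 : ℝ)..mtyD1 θ, (mtyH1 1 θ u : ℂ) * Complex.exp (-(z * u))
      = (fordSmoothW0 θ : ℂ) / z + (mtyH1Deriv2 1 θ 0 : ℂ) / z ^ 3
        + 1 / z ^ 3 * ∫ u in (0 : ℝ)..mtyD1 θ, (mtyH1Deriv3 1 θ u : ℂ) * Complex.exp (-(z * u)) := by
  have hT : Real.tan θ ≠ 0 := (Real.tan_pos_of_pos_of_lt_pi_div_two hθ hθ').ne'
  have h := laplace_eq_of_H1_third (d := mtyD1 θ) (hasDerivAt_mtyH1 one_ne_zero hT)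
    (hasDerivAt_mtyH1Deriv 1 θ) (hasDerivAt_mtyH1Deriv2 1 θ) (continuous_mtyH1Deriv3 1 θ)
    (by simpa using mtyH1_d1 (lam := 1) one_ne_zero hθ hθ')
    (mtyH1Deriv_zero 1 hθ hθ')
    (by simpa using mtyH1Deriv_d1 (lam := 1) one_ne_zero hθ hθ')
    (by simpa using mtyH1Deriv2_d1 (lam := 1) one_ne_zero hθ hθ') hz
  rw [h, mtyH1_one_zero hθ hθ']

/-- **Lemma 3.2, third-order form, for the MTY kernel** (`0 < θ < π/2`, `z ≠ 0`):
`|Re ∫₀^{d₁} h(u) e^{−zu} du − g₁(θ) Re z/‖z‖²| ≤ M₃(Re z)/‖z‖³`, `M₃ = mtyM3 θ`.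
[cite: Kadiri2005, Lemma 3.2] [cite: MossinghoffTrudgianYangRNT2024, §9] -/
theorem kadiri_lemma32_third_mtyH1 {θ : ℝ} (hθ : 0 < θ) (hθ' : θ < π / 2) {z : ℂ} (hz : z ≠ 0) :
    |(∫ u in (0 : ℝ)..mtyD1 θ, (mtyH1 1 θ u : ℂ) * Complex.exp (-(z * u))).re
        - fordSmoothW0 θ * z.re / ‖z‖ ^ 2| ≤ mtyM3 θ z.re / ‖z‖ ^ 3 := by
  have hT : Real.tan θ ≠ 0 := (Real.tan_pos_of_pos_of_lt_pi_div_two hθ hθ').ne'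
  have hd : 0 ≤ mtyD1 θ := by
    unfold mtyD1; linarith [theta_mul_cot_pos hθ hθ']
  have h := kadiri_lemma32_third hd (hasDerivAt_mtyH1 one_ne_zero hT)
    (hasDerivAt_mtyH1Deriv 1 θ) (hasDerivAt_mtyH1Deriv2 1 θ) (continuous_mtyH1Deriv3 1 θ)
    (by simpa using mtyH1_d1 (lam := 1) one_ne_zero hθ hθ')
    (mtyH1Deriv_zero 1 hθ hθ')
    (by simpa using mtyH1Deriv_d1 (lam := 1) one_ne_zero hθ hθ')
    (by simpa using mtyH1Deriv2_d1 (lam := 1) one_ne_zero hθ hθ') hz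
  rwa [mtyH1_one_zero hθ hθ'] at h

/-- **Lemma 3.2, third-order form, as printed for `f(t) = η h^{(1)}_{1,θ}(ηt)`**:
`F̃(x, y) = ηg₁(θ) x/(x² + y²) + H(x, y)` with `|H(x, y)| ≤ M₃(x/η) η³/(x² + y²)^{3/2}`
(`0 < θ < π/2`, `η > 0`, `(x, y) ≠ (0, 0)`). [cite: Kadiri2005, Lemma 3.2] -/
theorem kadiri_lemma32_third_scaled {θ η : ℝ} (hθ : 0 < θ) (hθ' : θ < π / 2) (hη : 0 < η) {z : ℂ}
    (hz : z ≠ 0) :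
    |(∫ t in (0 : ℝ)..(mtyD1 θ / η), (η * mtyH1 1 θ (η * t) : ℂ) * Complex.exp (-(z * t))).re
        - η * fordSmoothW0 θ * z.re / ‖z‖ ^ 2|
      ≤ mtyM3 θ (z.re / η) * η ^ 3 / ‖z‖ ^ 3 := by
  rw [kadiri_f_laplace_eq_scaled hη z]
  have hzη : z / η ≠ 0 := div_ne_zero hz (Complex.ofReal_ne_zero.2 hη.ne')
  have h := kadiri_lemma32_third_mtyH1 hθ hθ' hzη
  have hre : (z / η).re = z.re / η := by simp [Complex.div_ofReal_re]
  have hnorm2 : ‖z / η‖ ^ 2 = ‖z‖ ^ 2 / η ^ 2 := by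
    rw [norm_div, Complex.norm_real, Real.norm_eq_abs, abs_of_pos hη, div_pow]
  have hnorm3 : ‖z / η‖ ^ 3 = ‖z‖ ^ 3 / η ^ 3 := by
    rw [norm_div, Complex.norm_real, Real.norm_eq_abs, abs_of_pos hη, div_pow]
  rw [hre, hnorm2, hnorm3] at h
  have hz2 : 0 < ‖z‖ ^ 2 := by positivity
  have e1 : fordSmoothW0 θ * (z.re / η) / (‖z‖ ^ 2 / η ^ 2) = η * fordSmoothW0 θ * z.re / ‖z‖ ^ 2 := by
    field_simp
  have e2 : mtyM3 θ (z.re / η) / (‖z‖ ^ 3 / η ^ 3) = mtyM3 θ (z.re / η) * η ^ 3 / ‖z‖ ^ 3 := by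
    field_simp
  rwa [e1, e2] at h

namespace KadiriThird

variable {θ η : ℝ}

/-- **Third-order Lemma 3.2 for Kadiri's test function** `kadiriTest θ η`: for `z ≠ 0`,
`|Re F(z) − η g₁(θ) Re z/‖z‖²| ≤ M₃(Re z/η) η³/‖z‖³`. [cite: Kadiri2005, Lemma 3.2] -/
theorem abs_re_fordLaplace_sub_le (hθ : 0 < θ) (hθ' : θ < π / 2) (hη : 0 < η) {z : ℂ} (hz : z ≠ 0) :
    |(fordLaplace (kadiriTest θ η) z).re - η * fordSmoothW0 θ * z.re / ‖z‖ ^ 2| ≤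
      mtyM3 θ (z.re / η) * η ^ 3 / ‖z‖ ^ 3 := by
  rw [KadiriTest.fordLaplace_eq hθ hθ' hη]
  exact kadiri_lemma32_third_scaled hθ hθ' hη hz

/-- `M₃` is antitone (`e^{−xu} ≤ e^{−x'u}` on `u ≥ 0` for `x' ≤ x`). [folklore] -/
theorem mtyM3_antitone (hθ : 0 < θ) (hθ' : θ < π / 2) : Antitone (mtyM3 θ) := by
  intro x y hxy
  have hD := KadiriTest.mtyD1_pos hθ hθ'
  unfold mtyM3
  refine add_le_add le_rfl (intervalIntegral.integral_mono_on hD.le ?_ ?_ fun u hu ↦ ?_)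
  · exact ((continuous_abs.comp (continuous_mtyH1Deriv3 1 θ)).mul (by fun_prop)).intervalIntegrable _ _
  · exact ((continuous_abs.comp (continuous_mtyH1Deriv3 1 θ)).mul (by fun_prop)).intervalIntegrable _ _
  · refine mul_le_mul_of_nonneg_left (Real.exp_le_exp.2 ?_) (abs_nonneg _)
    nlinarith [hu.1]

/-- `M₃(x) ≥ 0`. [folklore] -/
theorem mtyM3_nonneg (hθ : 0 < θ) (hθ' : θ < π / 2) (x : ℝ) : 0 ≤ mtyM3 θ x := by
  have hD := KadiriTest.mtyD1_pos hθ hθ'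
  unfold mtyM3
  exact add_nonneg (abs_nonneg _)
    (intervalIntegral.integral_nonneg hD.le fun u _ ↦ mul_nonneg (abs_nonneg _) (Real.exp_nonneg _))

/-- **A crude bound for `|h'''|` on `[0, d₁]`** (triangle inequality in the closed form, using
`|θ − x/2| ≤ θ` for `x = u tan θ ∈ [0, 2θ]`):
`|h'''(u)| ≤ tan²θ sec²θ (sec²θ (3/2 + θ) + tan θ/sin 2θ + 2 tan θ/sin θ)`.
[cite: MossinghoffTrudgianYangRNT2024, (9.2)] -/
theorem abs_mtyH1Deriv3_le (hθ : 0 < θ) (hθ' : θ < π / 2) {u : ℝ} (hu0 : 0 ≤ u) (hu1 : u ≤ mtyD1 θ) :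
    |mtyH1Deriv3 1 θ u| ≤ Real.tan θ ^ 2 / Real.cos θ ^ 2 *
      (1 / Real.cos θ ^ 2 * (3 / 2 + θ) + Real.tan θ / Real.sin (2 * θ) +
        2 * Real.tan θ / Real.sin θ) := by
  have hθπ : θ < π := by linarith [Real.pi_pos]
  have hcos : 0 < Real.cos θ := Real.cos_pos_of_mem_Ioo ⟨by linarith, hθ'⟩
  have hsin : 0 < Real.sin θ := Real.sin_pos_of_pos_of_lt_pi hθ hθπ
  have htan : 0 < Real.tan θ := by rw [Real.tan_eq_sin_div_cos]; positivity
  have hsin2 : 0 < Real.sin (2 * θ) := Real.sin_pos_of_pos_of_lt_pi (by linarith) (by linarith)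
  set x : ℝ := u * Real.tan θ with hx
  have hx0 : 0 ≤ x := by positivity
  have hx1 : x ≤ 2 * θ := by
    have hd : mtyD1 θ * Real.tan θ = 2 * θ := by
      unfold mtyD1
      rw [Real.cot_eq_cos_div_sin, Real.tan_eq_sin_div_cos]
      field_simp
    calc x = u * Real.tan θ := hx
      _ ≤ mtyD1 θ * Real.tan θ := mul_le_mul_of_nonneg_right hu1 htan.le
      _ = 2 * θ := hd
  unfold mtyH1Deriv3
  simp only [one_pow, one_mul]
  rw [← hx, abs_mul, abs_of_pos (by positivity : 0 < Real.tan θ ^ 2 / Real.cos θ ^ 2)]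
  refine mul_le_mul_of_nonneg_left ?_ (by positivity)
  have hS : 0 < 1 / Real.cos θ ^ 2 := by positivity
  -- the three pieces
  have hc1 : |Real.cos x| ≤ 1 := Real.abs_cos_le_one x
  have hs1 : |Real.sin x| ≤ 1 := Real.abs_sin_le_one x
  have hc2 : |Real.cos (2 * θ - x)| ≤ 1 := Real.abs_cos_le_one _
  have hc3 : |Real.cos (θ - x)| ≤ 1 := Real.abs_cos_le_one _
  have hθx : |θ - x / 2| ≤ θ := by rw [abs_le]; constructor <;> linarith
  have p1 : |1 / Real.cos θ ^ 2 * (3 / 2 * Real.cos x + (θ - x / 2) * Real.sin x)| ≤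
      1 / Real.cos θ ^ 2 * (3 / 2 + θ) := by
    rw [abs_mul, abs_of_pos hS]
    refine mul_le_mul_of_nonneg_left ?_ hS.le
    calc |3 / 2 * Real.cos x + (θ - x / 2) * Real.sin x|
        ≤ |3 / 2 * Real.cos x| + |(θ - x / 2) * Real.sin x| := abs_add_le _ _
      _ = 3 / 2 * |Real.cos x| + |θ - x / 2| * |Real.sin x| := by
          rw [abs_mul, abs_mul, abs_of_pos (by norm_num : (0 : ℝ) < 3 / 2)]
      _ ≤ 3 / 2 * 1 + θ * 1 := by
          gcongr
      _ = 3 / 2 + θ := by ring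
  have p2 : |Real.tan θ * Real.cos (2 * θ - x) / Real.sin (2 * θ)| ≤ Real.tan θ / Real.sin (2 * θ) := by
    rw [abs_div, abs_mul, abs_of_pos htan, abs_of_pos hsin2]
    refine div_le_div_of_nonneg_right ?_ hsin2.le
    calc Real.tan θ * |Real.cos (2 * θ - x)| ≤ Real.tan θ * 1 := by gcongr
      _ = Real.tan θ := mul_one _
  have p3 : |2 * Real.tan θ * Real.cos (θ - x) / Real.sin θ| ≤ 2 * Real.tan θ / Real.sin θ := by
    rw [abs_div, abs_mul, abs_of_pos (by positivity : 0 < 2 * Real.tan θ), abs_of_pos hsin]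
    refine div_le_div_of_nonneg_right ?_ hsin.le
    calc 2 * Real.tan θ * |Real.cos (θ - x)| ≤ 2 * Real.tan θ * 1 := by gcongr
      _ = 2 * Real.tan θ := mul_one _
  calc |1 / Real.cos θ ^ 2 * (3 / 2 * Real.cos x + (θ - x / 2) * Real.sin x) +
          Real.tan θ * Real.cos (2 * θ - x) / Real.sin (2 * θ) -
          2 * Real.tan θ * Real.cos (θ - x) / Real.sin θ|
      ≤ |1 / Real.cos θ ^ 2 * (3 / 2 * Real.cos x + (θ - x / 2) * Real.sin x) +
          Real.tan θ * Real.cos (2 * θ - x) / Real.sin (2 * θ)| +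
          |2 * Real.tan θ * Real.cos (θ - x) / Real.sin θ| := abs_sub _ _
    _ ≤ (|1 / Real.cos θ ^ 2 * (3 / 2 * Real.cos x + (θ - x / 2) * Real.sin x)| +
          |Real.tan θ * Real.cos (2 * θ - x) / Real.sin (2 * θ)|) +
          |2 * Real.tan θ * Real.cos (θ - x) / Real.sin θ| := by gcongr; exact abs_add_le _ _
    _ ≤ _ := by linarith

/-- **Crude bound for `M₃(X)`**: `M₃(X) ≤ |h''(0)| + d₁ · m₃ · e^{|X| d₁}` when `|h'''| ≤ m₃` on
`[0, d₁]`. [folklore] -/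
theorem mtyM3_le_crude (hθ : 0 < θ) (hθ' : θ < π / 2) {m₃ : ℝ}
    (hm : ∀ u ∈ Icc 0 (mtyD1 θ), |mtyH1Deriv3 1 θ u| ≤ m₃) (X : ℝ) :
    mtyM3 θ X ≤ |mtyH1Deriv2 1 θ 0| + mtyD1 θ * (m₃ * Real.exp (|X| * mtyD1 θ)) := by
  have hD := KadiriTest.mtyD1_pos hθ hθ'
  unfold mtyM3
  refine add_le_add le_rfl ?_
  have hle : ∀ u ∈ Icc 0 (mtyD1 θ), |mtyH1Deriv3 1 θ u| * Real.exp (-(X * u)) ≤ m₃ * Real.exp (|X| * mtyD1 θ) := by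
    intro u hu
    have hm0 : 0 ≤ m₃ := (abs_nonneg _).trans (hm u hu)
    refine mul_le_mul (hm u hu) (Real.exp_le_exp.2 ?_) (Real.exp_nonneg _) hm0
    have h1 : -(X * u) ≤ |X| * u := by
      have := neg_abs_le X; nlinarith [hu.1]
    have h2 : |X| * u ≤ |X| * mtyD1 θ := mul_le_mul_of_nonneg_left hu.2 (abs_nonneg X)
    linarith
  calc ∫ u in (0 : ℝ)..mtyD1 θ, |mtyH1Deriv3 1 θ u| * Real.exp (-(X * u))
      ≤ ∫ _ in (0 : ℝ)..mtyD1 θ, m₃ * Real.exp (|X| * mtyD1 θ) := by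
        refine intervalIntegral.integral_mono_on hD.le ?_ (by simp) hle
        exact ((continuous_abs.comp (continuous_mtyH1Deriv3 1 θ)).mul (by fun_prop)).intervalIntegrable _ _
    _ = mtyD1 θ * (m₃ * Real.exp (|X| * mtyD1 θ)) := by
        rw [intervalIntegral.integral_const, smul_eq_mul, sub_zero]

/-- **The far-zero remainder in the shape of `KadiriZeroSum.abs_H_le`**: for `|y| ≥ t₀ > 0` and
`M₃(x/η) η ≤ M* t₀`, `|H(x, y)| ≤ M* η²/y²`. [cite: Kadiri2005, Lemma 3.2 and Prop. 4.4] -/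
theorem abs_H_le (hθ : 0 < θ) (hθ' : θ < π / 2) (hη : 0 < η) {x y t₀ Mst : ℝ} (ht₀ : 0 < t₀)
    (hy : t₀ ≤ |y|) (hM : mtyM3 θ (x / η) * η ≤ Mst * t₀) :
    |(fordLaplace (kadiriTest θ η) ((x : ℂ) + y * I)).re - η * fordSmoothW0 θ * x / (x ^ 2 + y ^ 2)| ≤
      Mst * η ^ 2 / y ^ 2 := by
  have hy0 : 0 < |y| := ht₀.trans_le hy
  have hyne : y ≠ 0 := abs_pos.1 hy0
  set z : ℂ := (x : ℂ) + y * I with hz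
  have hz0 : z ≠ 0 := fun e ↦ by have := congrArg Complex.im e; simp [hz] at this; exact hyne this
  have hn : ‖z‖ ^ 2 = x ^ 2 + y ^ 2 := by rw [Complex.sq_norm, Complex.normSq_apply]; simp [hz]; ring
  have hzre : z.re = x := by simp [hz]
  have h := abs_re_fordLaplace_sub_le hθ hθ' hη hz0
  rw [hzre, hn] at h
  refine h.trans ?_
  have hM0 : 0 ≤ mtyM3 θ (x / η) := mtyM3_nonneg hθ hθ' _
  have hMst0 : 0 ≤ Mst := by
    have : 0 ≤ Mst * t₀ := (mul_nonneg hM0 hη.le).trans hM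
    exact (mul_nonneg_iff_of_pos_right ht₀).1 this
  -- `‖z‖ ≥ |y| ≥ t₀`
  have hzy : |y| ≤ ‖z‖ := by
    have : |z.im| ≤ ‖z‖ := Complex.abs_im_le_norm z
    simpa [hz] using this
  have hz3 : |y| ^ 3 ≤ ‖z‖ ^ 3 := by gcongr
  have hy3 : 0 < |y| ^ 3 := by positivity
  calc mtyM3 θ (x / η) * η ^ 3 / ‖z‖ ^ 3
      ≤ mtyM3 θ (x / η) * η ^ 3 / |y| ^ 3 := div_le_div_of_nonneg_left (by positivity) hy3 hz3
    _ = (mtyM3 θ (x / η) * η) * η ^ 2 / (|y| * |y| ^ 2) := by ring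
    _ ≤ (Mst * t₀) * η ^ 2 / (|y| * |y| ^ 2) := by gcongr
    _ ≤ (Mst * |y|) * η ^ 2 / (|y| * |y| ^ 2) := by gcongr
    _ = Mst * η ^ 2 / y ^ 2 := by
        rw [show |y| ^ 2 = y ^ 2 from sq_abs y]
        field_simp

end KadiriThird

end Literature.NumberTheory.LFunctions
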